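import Summits.QuantumFields.BalabanUV.Beta.GAN24.LayerPushFrozenSlice
import Summits.QuantumFields.BalabanUV.Beta.GAN24.Push4NestTable
import Summits.QuantumFields.BalabanUV.Beta.GAN24.Push4NestAux

/-!
# `BalabanUV.Beta.GAN24.LayerPushFrozen` — binder row G-an2-4 / (CONV-C), W-slot CT-W, route «WC-TL» ∕ «QR-LL» (gan24-p1 g25 `gen25/QR-DESIGN-v0.md` §3, RULINGS R-gan24p1-g25-2
# (3) «where does the boundary term go?» and R-gan24p1-g25-11 «(LT-1″) … expected net t·L^{−1} at d = 3, to be CONFIRMED by the count»), row **(LT-Δ) «LAYER TRANSPORT»**,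
# part (LT-1″b) — THE PUSH OF A WEIGHTED FAMILY EQUALS ITS FROZEN CHARGE TERM UP TO ONE GRADIENT CONSTANT; zero per-slot charge ⇒ the (LT-Δ) gain

NOT IN PRINT; OUR BOOKKEEPING ([folklore] assembly over part (LT-1″a) `GAN24/LayerPushFrozenSlice`, leaf-17's `Push4NestTable.vertexW_comp_left ∕ _right ∕ vertexW_ffRead` and
`Push4NestAux` (the slot outermost), this lineage's `LayerPushEntry` (p318356: the weighted block count, `exp_three_le`); G-an2-4 formalisation swarm, leaf prover
`b2b-balaban-gan24-formalise-leaf-01`, gen 63).  HONEST FRAMING (cell contract, verbatim): «discharging `BetaPertH` makes Bałaban's UV stability UNCONDITIONAL — a real constructive-QFT result; it is NOT the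
continuum limit and NOT the Clay problem.»  HONEST DEPENDENCY (verbatim): «continuum YM on T⁴ ⇐ BetaPertH ∧ nine spine estimates (0/9 proved); BetaPertH ⇐ (D1) ∧ (D4) ∧
CAP+tail; G-an2-4 gates asym, D1 and NE2/3/4.»

## What (generic `d`, relative blocking `N ≥ 1`, GENERIC legs ∕ weights ∕ families — no object of an2's typed system occurs)
§2 `sand_inl_inl` (entry formula of the two-leg sandwich `ffRead (Lk l ∘ K ∘ Rk r)`), **`push₃_eq_vertexW_sand`**: `push₃ l r w S ν U = vertexW w (k u ↦ ffRead (Lk l ∘ S k u ∘ Rk r)) ν U`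
   — the table leg OUTERMOST against the sandwiches of the family's kernels (summable legs, bounded ∕ decaying family).
§3 **`abs_push₃_sub_frozen_le_weighted`** — legs with coarse envelopes `Cl, Cr, Cw` (rate `κ`, `‖quo N · − ·‖₁` currency of `LayerPushEntry`) AND coarse UNIT-GRADIENT envelopes
   `Cl′, Cr′` for the two KERNEL legs (the `ℓ¹` twins of (N1′) `RespStepDecay.exists_respStep_decay_and_grad` — one power of the blocking better), family with the weighted slot
   profile `|S κ′ u x z a b| ≤ Cs·ω u·e^{−m(‖x−u‖₁+‖z−u‖₁)}`, `0 ≤ ω ≤ Ω`, `0 < κ < m`: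
   `|push₃ l r w S ν U x′ z′ (inl α) (inl β) − FROZEN| ≤ (d+1)³·Cw·Cs·M₁·(Cr′·Cl·Zl(m−κ) + Cr·Cl′·Zl m)·e^{−(κ∕4)(‖x′−U‖₁+‖z′−U‖₁)}·Σ'_u ω u·e^{−(κ∕2)‖quo N u − U‖₁}`,
   `FROZEN := Σ_{κ′} Σ'_u w ν U κ′ u·Σ_{κ₂ κ₁} l α x′ κ₁ u·r β z′ κ₂ u·(Σ'_x Σ'_z S κ′ u x z (inl κ₁) (inl κ₂))` DISPLAYED — the three legs AT THE SLOT against the per-slot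
   field–field CHARGE.  So: the remainder carries exactly ONE gradient constant against the weighted block count of the family's OWN slot support (shell AND gradient on
   the same term, on DIFFERENT indices — slot support vs kernel legs: no summation by parts over a box, no boundary term); the frozen term is the CHARGED part, of
   `LayerPushEntry`'s bare size.  **`abs_push₃_inl_inl_le_of_zeroCharge`**: zero per-slot charge at every fibre pair ⇒ the push itself obeys the remainder bound (the (LT-Δ)
   gain; with (N1′) legs at `d = 3` this is the `t·L^{−1}` of the OWNER's R11 — the exponent bookkeeping in row-V currency is part (LT-3), not here).
§4 **`charge_comm_antisymm`**, `charge_comm_diag_eq_zero`: for `K` with a SYMMETRIC FIELD–FIELD BLOCK (`K x z (inl κ₁)(inl κ₂) = K z x (inl κ₂)(inl κ₁)` — the co-dressed step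
   resolvent is `sgnK`-symmetric by name, hence ff-symmetric) and a bounded multiplier `g` on (site × fibre), the commutator letter `K x z a b·(g z b − g x a)` has a per-slot
   field–field charge MATRIX antisymmetric in the fibre pair — diagonal zero; off-diagonal NOT asserted to vanish (W11 (1); leaf-03 g59's `LayerCommutatorAntisymm` §3 is the
   abstract-kernel twin).
[folklore]; 0 cited facts, 0 `def`, 0 `def … : Prop`, 0 sorry.  Asserts NOTHING about an2's towers or about K-LL-3; NEVER «G-an2-4 closed» as (CONV-C); NOT D1, NOT `BetaPertH`,
NOT continuum, NOT Clay.  2026-08-22.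
-/

noncomputable section

open Finset
open scoped BigOperators
open Literature.MathematicalPhysics.QuantumFieldTheory
open Literature.MathematicalPhysics.QuantumFieldTheory.Balaban1983to89
open Literature.MathematicalPhysics.QuantumFieldTheory.Balaban1983to89.Beta
open B12Sec2to5 (l1 l1_nonneg)
open ExpKernelCalculus (MKer Decays comp Zl Zl_nonneg Zl_pos summable_exp_shift summable_exp_shift' tsum_exp_shift' l1_sub_triangle l1_sub_symm)
open OneStepResolventKernel (Fib wsum)
open LatticeForm (quo)
open KernelWard (ProdBound tsum_comm_of_prodBound)
open Summit.QuantumFields.BalabanUV.Beta.GAN24.Push4 (vertexW vertexW_apply Lk Rk ffRead Lk_inl_inl Lk_inl_inr Lk_inr Rk_inl_inl Rk_inr_left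
  Rk_inr_right ffRead_inl_inl)
open Summit.QuantumFields.BalabanUV.Beta.GAN24.Push3 (push₃ push₃_inl_inl push₃_def)
open Summit.QuantumFields.BalabanUV.Beta.GAN24.Push4TwoRate (summable_leg)
open Summit.QuantumFields.BalabanUV.Beta.GAN24.Push4NestTable (vertexW_comp_left vertexW_comp_right vertexW_ffRead)
open Summit.QuantumFields.BalabanUV.Beta.GAN24.Push4NestAux (summable_Lk_row summable_Rk_col abs_comp_Lk_le_of_decays)
open Summit.QuantumFields.BalabanUV.Beta.GAN24.LayerPushEntry (abs_tsum_le_tsum_of_abs_le exp_three_le)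
open Summit.QuantumFields.BalabanUV.Beta.GAN24.LayerPushFrozenSlice (leg_rel_sup leg_rel_lip abs_sand_sub_frozen_le abs_sand_le abs_frozen_le)

namespace Summit.QuantumFields.BalabanUV.Beta.GAN24.LayerPushFrozen

variable {d : ℕ}

/-! ## §2 The slot outermost: the three-leg push is the table leg against the two-leg sandwiches of the family's kernels -/

section SlotOut

variable {l r w : Fin (d + 1) → (Fin (d + 1) → ℤ) → Fin (d + 1) → (Fin (d + 1) → ℤ) → ℝ}
  {S : Fin (d + 1) → (Fin (d + 1) → ℤ) → MKer (d + 1) (Fib d)}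

/-- [folklore] **ENTRY FORMULA OF THE TWO-LEG SANDWICH** of one kernel:
`ffRead (Lk l ∘ K ∘ Rk r) x′ z′ (inl α) (inl β) = Σ'_z Σ_{κ₂} (Σ'_x Σ_{κ₁} l α x′ κ₁ x·K x z κ₁ κ₂)·r β z′ κ₂ z`. -/
theorem sand_inl_inl (K : MKer (d + 1) (Fib d)) (x' z' : Fin (d + 1) → ℤ) (α β : Fin (d + 1)) :
    ffRead (comp (comp (Lk l) K) (Rk r)) x' z' (Sum.inl α) (Sum.inl β)
      = ∑' z, ∑ κ₂ : Fin (d + 1), (∑' x, ∑ κ₁ : Fin (d + 1), l α x' κ₁ x * K x z (Sum.inl κ₁) (Sum.inl κ₂)) * r β z' κ₂ z := by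
  simp only [ffRead_inl_inl, comp]
  refine tsum_congr fun z => ?_
  rw [Fintype.sum_sum_type]
  simp only [Rk_inl_inl, Rk_inr_left, mul_zero, Finset.sum_const_zero, add_zero]
  refine Finset.sum_congr rfl fun κ₂ _ => ?_
  congr 1
  refine tsum_congr fun x => ?_
  rw [Fintype.sum_sum_type]
  simp only [Lk_inl_inl, Lk_inl_inr, zero_mul, Finset.sum_const_zero, add_zero]

/-- [folklore] **THE SLOT OUTERMOST** (leaf-17's `vertexW_comp_left` ∕ `_right` ∕ `vertexW_ffRead`): with summable legs, a bounded left leg, and a uniformly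
bounded, uniformly decaying family, `push₃ l r w S ν U = vertexW w (k u ↦ ffRead (Lk l ∘ S k u ∘ Rk r)) ν U` — the table leg against the two-leg
sandwiches of the family's kernels. -/
theorem push₃_eq_vertexW_sand {Bl CT δ : ℝ} (ν : Fin (d + 1)) (U : Fin (d + 1) → ℤ) (hws : ∀ k, Summable fun u => w ν U k u)
    (hls : ∀ α x' k, Summable fun x => l α x' k x) (hrs : ∀ β z' k, Summable fun z => r β z' k z)
    (hlb : ∀ α x' k x, |l α x' k x| ≤ Bl) (hBl : 0 ≤ Bl) (hSb : ∀ k u x z a b, |S k u x z a b| ≤ CT)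
    (hSd : ∀ k u, Decays (S k u) CT δ) (hδ : 0 < δ) :
    push₃ l r w S ν U = vertexW w (fun k u => ffRead (comp (comp (Lk l) (S k u)) (Rk r))) ν U := by
  have h1 : vertexW w (fun k u => comp (Lk l) (S k u)) ν U = comp (Lk l) (vertexW w S ν U) :=
    vertexW_comp_left (r := w) (T := S) hws (fun x a f => summable_Lk_row hls x a f) hSb
  have hT' : ∀ k u x y a f, |comp (Lk l) (S k u) x y a f| ≤ (d + 1 : ℕ) * (Bl * CT * Zl (d + 1) δ) :=
    fun k u x y a f => abs_comp_Lk_le_of_decays hlb hBl (hSd k u) hδ x y a f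
  have h2 : vertexW w (fun k u => comp (comp (Lk l) (S k u)) (Rk r)) ν U
      = comp (vertexW w (fun k u => comp (Lk l) (S k u)) ν U) (Rk r) :=
    vertexW_comp_right (r := w) hws (fun z f b => summable_Rk_col hrs z f b) hT'
  have h3 : vertexW w (fun k u => ffRead (comp (comp (Lk l) (S k u)) (Rk r))) ν U
      = ffRead (vertexW w (fun k u => comp (comp (Lk l) (S k u)) (Rk r)) ν U) :=
    vertexW_ffRead (r := w) _ ν U
  rw [h3, h2, h1, push₃_def]

end SlotOut

/-! ## §3 The weighted family through coarse legs: the push equals its FROZEN CHARGE TERM up to one gradient constant -/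

/-- [folklore] Monotonicity of a four-fold product with nonnegative factors. -/
theorem prod4_le {D a A b B c C t : ℝ} (hD : 0 ≤ D) (ha : 0 ≤ a) (haA : a ≤ A) (hb : 0 ≤ b) (hbB : b ≤ B) (hc : 0 ≤ c) (hcC : c ≤ C)
    (ht : 0 ≤ t) : D * a * b * c * t ≤ D * A * B * C * t := by
  have hA : 0 ≤ A := ha.trans haA
  have hB : 0 ≤ B := hb.trans hbB
  have hC : 0 ≤ C := hc.trans hcC
  have h1 : D * a ≤ D * A := mul_le_mul_of_nonneg_left haA hD
  have h2 : D * a * b ≤ D * A * B := mul_le_mul h1 hbB hb (by positivity)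
  have h3 : D * a * b * c ≤ D * A * B * C := mul_le_mul h2 hcC hc (by positivity)
  exact mul_le_mul_of_nonneg_right h3 ht

section Main

variable {l r w : Fin (d + 1) → (Fin (d + 1) → ℤ) → Fin (d + 1) → (Fin (d + 1) → ℤ) → ℝ}
  {S : Fin (d + 1) → (Fin (d + 1) → ℤ) → MKer (d + 1) (Fib d)} {ω : (Fin (d + 1) → ℤ) → ℝ} {N : ℕ} {Cl Cl' Cr Cr' Cw Cs κ m Ω : ℝ}

/-- NOT IN PRINT; OUR BOOKKEEPING (§2, then §1 slot by slot, then the weighted block count of `LayerPushEntry` §0).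
**THE PUSH OF A WEIGHTED FAMILY EQUALS ITS FROZEN CHARGE TERM UP TO ONE GRADIENT CONSTANT** (generic `d`, relative blocking `N ≥ 1`, rates `0 < κ < m`).
Legs: coarse envelopes `|l α x′ κ₁ x| ≤ Cl·e^{−κ‖quo N x − x′‖₁}`, `|r β z′ κ₂ z| ≤ Cr·e^{−κ‖quo N z − z′‖₁}`, `|w ν U κ′ u| ≤ Cw·e^{−κ‖quo N u − U‖₁}` AND unit-gradient
coarse envelopes for the two KERNEL legs, `|l α x′ κ₁ (x + e_i) − l α x′ κ₁ x| ≤ Cl′·e^{−κ‖quo N x − x′‖₁}`, `|r β z′ κ₂ (z + e_i) − r β z′ κ₂ z| ≤ Cr′·e^{−κ‖quo N z − z′‖₁}`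
(the `ℓ¹` twins of (N1′) `RespStepDecay.exists_respStep_decay_and_grad`: `Cl′, Cr′` one power of the blocking better than `Cl, Cr`).  Family: the weighted slot
profile `|S κ′ u x z a b| ≤ Cs·ω u·e^{−m(‖x−u‖₁+‖z−u‖₁)}`, `0 ≤ ω ≤ Ω`.  FROZEN CHARGE TERM (displayed): the table leg and the two kernel legs evaluated AT THE SLOT,
against the per-slot field–field charge `Σ'_x Σ'_z S κ′ u x z (inl κ₁) (inl κ₂)`.  Then
`|push₃ l r w S ν U x′ z′ (inl α) (inl β) − Σ_{κ′} Σ'_u w ν U κ′ u·Σ_{κ₂} Σ_{κ₁} l α x′ κ₁ u·r β z′ κ₂ u·(Σ'_x Σ'_z S κ′ u x z (inl κ₁) (inl κ₂))|`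
`≤ (d+1)³·Cw·Cs·M₁·(Cr′·Cl·Zl(m−κ) + Cr·Cl′·Zl m) · e^{−(κ∕4)(‖x′−U‖₁+‖z′−U‖₁)} · Σ'_u ω u·e^{−(κ∕2)‖quo N u − U‖₁}`, `M₁ := (2∕(m−κ))·Zl((m−κ)∕2)`:
every remainder carries EXACTLY ONE gradient constant `Cl′` or `Cr′` — against the weighted block count of the family's OWN slot support.  For a family with
VANISHING PER-SLOT FIELD–FIELD CHARGE the frozen term is `0` (`abs_push₃_inl_inl_le_of_zeroCharge`). -/
theorem abs_push₃_sub_frozen_le_weighted (hN : 1 ≤ N)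
    (hl : ∀ α x' k x, |l α x' k x| ≤ Cl * Real.exp (-κ * l1 (quo N x - x')))
    (hl' : ∀ α x' k x i, |l α x' k (x + Pi.single i 1) - l α x' k x| ≤ Cl' * Real.exp (-κ * l1 (quo N x - x')))
    (hr : ∀ β z' k z, |r β z' k z| ≤ Cr * Real.exp (-κ * l1 (quo N z - z')))
    (hr' : ∀ β z' k z i, |r β z' k (z + Pi.single i 1) - r β z' k z| ≤ Cr' * Real.exp (-κ * l1 (quo N z - z')))
    (hw : ∀ ν U k u, |w ν U k u| ≤ Cw * Real.exp (-κ * l1 (quo N u - U)))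
    (hS : ∀ k u x z a b, |S k u x z a b| ≤ Cs * ω u * Real.exp (-m * (l1 (x - u) + l1 (z - u))))
    (hω : ∀ u, 0 ≤ ω u ∧ ω u ≤ Ω) (hκ : 0 < κ) (hm : κ < m) (hCl : 0 ≤ Cl) (hCl' : 0 ≤ Cl') (hCr : 0 ≤ Cr) (hCr' : 0 ≤ Cr')
    (hCs : 0 ≤ Cs) (ν : Fin (d + 1)) (U x' z' : Fin (d + 1) → ℤ) (α β : Fin (d + 1)) :
    |push₃ l r w S ν U x' z' (Sum.inl α) (Sum.inl β)
        - ∑ k : Fin (d + 1), ∑' u : Fin (d + 1) → ℤ, w ν U k u *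
            ∑ κ₂ : Fin (d + 1), ∑ κ₁ : Fin (d + 1), l α x' κ₁ u * r β z' κ₂ u *
              ∑' x, ∑' z, S k u x z (Sum.inl κ₁) (Sum.inl κ₂)|
      ≤ (((d : ℝ) + 1) ^ 3 * Cw * Cs * (2 / (m - κ) * Zl (d + 1) ((m - κ) / 2)) *
          (Cr' * Cl * Zl (d + 1) (m - κ) + Cr * Cl' * Zl (d + 1) m)) *
        Real.exp (-(κ / 4) * (l1 (x' - U) + l1 (z' - U))) *
          ∑' u : Fin (d + 1) → ℤ, ω u * Real.exp (-(κ / 2) * l1 (quo N u - U)) := by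
  -- (0) constants
  have hκ0 := hκ.le
  have hm0 : 0 < m := hκ.trans hm
  have hmk : 0 < m - κ := sub_pos.2 hm
  have hCw : 0 ≤ Cw := (mul_nonneg_iff_of_pos_right (Real.exp_pos _)).mp ((abs_nonneg _).trans (hw 0 0 0 0))
  have hΩ : 0 ≤ Ω := (hω 0).1.trans (hω 0).2
  have hZ1 : 0 ≤ Zl (d + 1) (m - κ) := Zl_nonneg hmk
  have hZm : 0 ≤ Zl (d + 1) m := Zl_nonneg hm0
  have hM₁ : 0 ≤ 2 / (m - κ) * Zl (d + 1) ((m - κ) / 2) := by have := Zl_nonneg (D := d + 1) (half_pos hmk); positivity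
  have he1 : ∀ (c : ℝ) (v : Fin (d + 1) → ℤ), 0 ≤ c → Real.exp (-c * l1 v) ≤ 1 := fun c v hc =>
    Real.exp_le_one_iff.2 (by nlinarith [l1_nonneg v])
  -- (1) summability and uniform bounds of the legs and of the family
  have hws : ∀ ν' U' k, Summable fun u => w ν' U' k u := fun ν' U' k =>
    Summable.of_norm_bounded ((summable_leg (d := d) hN hκ U').mul_left Cw) fun u => by rw [Real.norm_eq_abs]; exact hw ν' U' k u
  have hls : ∀ α' x'' k, Summable fun x => l α' x'' k x := fun α' x'' k =>
    Summable.of_norm_bounded ((summable_leg (d := d) hN hκ x'').mul_left Cl) fun x => by rw [Real.norm_eq_abs]; exact hl α' x'' k x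
  have hrs : ∀ β' z'' k, Summable fun z => r β' z'' k z := fun β' z'' k =>
    Summable.of_norm_bounded ((summable_leg (d := d) hN hκ z'').mul_left Cr) fun z => by rw [Real.norm_eq_abs]; exact hr β' z'' k z
  have hlb : ∀ α' x'' k x, |l α' x'' k x| ≤ Cl := fun α' x'' k x =>
    (hl α' x'' k x).trans (mul_le_of_le_one_right hCl (he1 κ _ hκ0))
  have hSb : ∀ k u x z a b, |S k u x z a b| ≤ Cs * Ω := by
    intro k u x z a b
    refine (hS k u x z a b).trans ?_
    have e1 : Real.exp (-m * (l1 (x - u) + l1 (z - u))) ≤ 1 :=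
      Real.exp_le_one_iff.2 (by nlinarith [l1_nonneg (x - u), l1_nonneg (z - u)])
    calc Cs * ω u * Real.exp (-m * (l1 (x - u) + l1 (z - u))) ≤ Cs * Ω * 1 :=
          mul_le_mul (mul_le_mul_of_nonneg_left (hω u).2 hCs) e1 (Real.exp_pos _).le (by positivity)
      _ = Cs * Ω := mul_one _
  have hSd : ∀ k u, Decays (S k u) (Cs * Ω) m := by
    intro k u x z a b
    refine (hS k u x z a b).trans ?_
    have ht : l1 (x - z) ≤ l1 (x - u) + l1 (z - u) := by
      have h := l1_sub_triangle x u z; rw [l1_sub_symm u z] at h; exact h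
    have e2 : Real.exp (-m * (l1 (x - u) + l1 (z - u))) ≤ Real.exp (-m * l1 (x - z)) :=
      Real.exp_le_exp.2 (by nlinarith)
    calc Cs * ω u * Real.exp (-m * (l1 (x - u) + l1 (z - u))) ≤ Cs * Ω * Real.exp (-m * l1 (x - z)) :=
          mul_le_mul (mul_le_mul_of_nonneg_left (hω u).2 hCs) e2 (Real.exp_pos _).le (by positivity)
      _ = Cs * Ω * Real.exp (-m * l1 (x - z)) := rfl
  -- (2) the slot outermost
  rw [push₃_eq_vertexW_sand ν U (hws ν U) hls hrs hlb hCl hSb hSd hm0, vertexW_apply]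
  -- (3) per slot: the sandwich, its frozen term, the remainder with ONE gradient constant
  set A₀ : ℝ := ((d : ℝ) + 1) ^ 2 * Cs * (2 / (m - κ) * Zl (d + 1) ((m - κ) / 2)) *
    (Cr' * Cl * Zl (d + 1) (m - κ) + Cr * Cl' * Zl (d + 1) m) with hA₀
  have hA₀0 : 0 ≤ A₀ := by rw [hA₀]; positivity
  set El : (Fin (d + 1) → ℤ) → ℝ := fun u => Real.exp (-κ * l1 (quo N u - x')) with hEl
  set Er : (Fin (d + 1) → ℤ) → ℝ := fun u => Real.exp (-κ * l1 (quo N u - z')) with hEr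
  set EU : (Fin (d + 1) → ℤ) → ℝ := fun u => Real.exp (-κ * l1 (quo N u - U)) with hEU
  set sandE : Fin (d + 1) → (Fin (d + 1) → ℤ) → ℝ := fun k u =>
    ffRead (comp (comp (Lk l) (S k u)) (Rk r)) x' z' (Sum.inl α) (Sum.inl β) with hsandE
  set frozE : Fin (d + 1) → (Fin (d + 1) → ℤ) → ℝ := fun k u =>
    ∑ κ₂ : Fin (d + 1), ∑ κ₁ : Fin (d + 1), l α x' κ₁ u * r β z' κ₂ u * ∑' x, ∑' z, S k u x z (Sum.inl κ₁) (Sum.inl κ₂) with hfrozE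
  have hKu : ∀ k u x z κ₁ κ₂, |S k u x z (Sum.inl κ₁) (Sum.inl κ₂)| ≤ (Cs * ω u) * Real.exp (-m * (l1 (x - u) + l1 (z - u))) :=
    fun k u x z κ₁ κ₂ => (hS k u x z _ _).trans (le_of_eq (by ring))
  have hlu : ∀ u κ₁ x, |l α x' κ₁ x| ≤ Cl * El u * Real.exp (κ * l1 (x - u)) := fun u κ₁ x =>
    leg_rel_sup hN hκ0 hCl (f := fun k x => l α x' k x) (fun k x => hl α x' k x) u κ₁ x
  have hlu' : ∀ u κ₁ x, |l α x' κ₁ x - l α x' κ₁ u| ≤ Cl' * El u * l1 (x - u) * Real.exp (κ * l1 (x - u)) := fun u κ₁ x =>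
    leg_rel_lip hN hκ0 hCl' (f := fun k x => l α x' k x) (fun k x i => hl' α x' k x i) u κ₁ x
  have hru : ∀ u κ₂ z, |r β z' κ₂ z| ≤ Cr * Er u * Real.exp (κ * l1 (z - u)) := fun u κ₂ z =>
    leg_rel_sup hN hκ0 hCr (f := fun k z => r β z' k z) (fun k z => hr β z' k z) u κ₂ z
  have hru' : ∀ u κ₂ z, |r β z' κ₂ z - r β z' κ₂ u| ≤ Cr' * Er u * l1 (z - u) * Real.exp (κ * l1 (z - u)) := fun u κ₂ z =>
    leg_rel_lip hN hκ0 hCr' (f := fun k z => r β z' k z) (fun k z i => hr' β z' k z i) u κ₂ z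
  have hEl0 : ∀ u, 0 ≤ El u := fun u => (Real.exp_pos _).le
  have hEr0 : ∀ u, 0 ≤ Er u := fun u => (Real.exp_pos _).le
  have hEl1 : ∀ u, El u ≤ 1 := fun u => he1 κ _ hκ0
  have hEr1 : ∀ u, Er u ≤ 1 := fun u => he1 κ _ hκ0
  -- the per-slot remainder
  have hrem : ∀ k u, |sandE k u - frozE k u| ≤ A₀ * ω u * (Er u * El u) := by
    intro k u
    have hω0 := (hω u).1
    rw [hsandE, hfrozE]
    simp only []
    rw [sand_inl_inl]
    have h := abs_sand_sub_frozen_le (lx := fun κ₁ x => l α x' κ₁ x) (rz := fun κ₂ z => r β z' κ₂ z) (K := S k u) (u := u)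
      hm hκ0 (by positivity : 0 ≤ Cs * ω u) (by positivity : 0 ≤ Cl * El u) (by positivity : 0 ≤ Cl' * El u)
      (by positivity : 0 ≤ Cr * Er u) (by positivity : 0 ≤ Cr' * Er u)
      (hKu k u) (hlu u) (hlu' u) (hru u) (hru' u)
    refine h.trans (le_of_eq ?_)
    rw [hA₀]; ring
  -- sizes (for summability of the two slot series)
  have hsand : ∀ k u, |sandE k u| ≤ ((d : ℝ) + 1) ^ 2 * Cr * Cl * (Cs * Ω) * Zl (d + 1) (m - κ) ^ 2 := by
    intro k u
    have hω0 := (hω u).1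
    rw [hsandE]
    simp only []
    rw [sand_inl_inl]
    have h := abs_sand_le (lx := fun κ₁ x => l α x' κ₁ x) (rz := fun κ₂ z => r β z' κ₂ z) (K := S k u) (u := u)
      hm (by positivity : 0 ≤ Cl * El u) (by positivity : 0 ≤ Cr * Er u) (hKu k u) (hlu u) (hru u)
    refine h.trans ?_
    have h1 : Cr * Er u ≤ Cr := mul_le_of_le_one_right hCr (hEr1 u)
    have h2 : Cl * El u ≤ Cl := mul_le_of_le_one_right hCl (hEl1 u)
    have h3 : Cs * ω u ≤ Cs * Ω := mul_le_mul_of_nonneg_left (hω u).2 hCs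
    exact prod4_le (by positivity) (by positivity) h1 (by positivity) h2 (by positivity) h3 (by positivity)
  have hfroz : ∀ k u, |frozE k u| ≤ ((d : ℝ) + 1) ^ 2 * Cl * Cr * (Cs * Ω) * Zl (d + 1) m ^ 2 := by
    intro k u
    have hω0 := (hω u).1
    rw [hfrozE]
    have h := abs_frozen_le (lx := fun κ₁ x => l α x' κ₁ x) (rz := fun κ₂ z => r β z' κ₂ z) (K := S k u) (u := u)
      hm hκ0 (by positivity : 0 ≤ Cl * El u) (by positivity : 0 ≤ Cr * Er u) (hKu k u) (hlu u) (hru u)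
    refine h.trans ?_
    have h1 : Cr * Er u ≤ Cr := mul_le_of_le_one_right hCr (hEr1 u)
    have h2 : Cl * El u ≤ Cl := mul_le_of_le_one_right hCl (hEl1 u)
    have h3 : Cs * ω u ≤ Cs * Ω := mul_le_mul_of_nonneg_left (hω u).2 hCs
    exact prod4_le (by positivity) (by positivity) h2 (by positivity) h1 (by positivity) h3 (by positivity)
  have hsumS : ∀ k, Summable fun u => w ν U k u * sandE k u := fun k =>
    Summable.of_norm_bounded ((summable_leg (d := d) hN hκ U).mul_left
      (Cw * (((d : ℝ) + 1) ^ 2 * Cr * Cl * (Cs * Ω) * Zl (d + 1) (m - κ) ^ 2))) fun u => by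
        rw [Real.norm_eq_abs, abs_mul]
        calc |w ν U k u| * |sandE k u| ≤ (Cw * Real.exp (-κ * l1 (quo N u - U))) *
              (((d : ℝ) + 1) ^ 2 * Cr * Cl * (Cs * Ω) * Zl (d + 1) (m - κ) ^ 2) :=
              mul_le_mul (hw ν U k u) (hsand k u) (abs_nonneg _) (by positivity)
          _ = _ := by ring
  have hsumF : ∀ k, Summable fun u => w ν U k u * frozE k u := fun k =>
    Summable.of_norm_bounded ((summable_leg (d := d) hN hκ U).mul_left
      (Cw * (((d : ℝ) + 1) ^ 2 * Cl * Cr * (Cs * Ω) * Zl (d + 1) m ^ 2))) fun u => by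
        rw [Real.norm_eq_abs, abs_mul]
        calc |w ν U k u| * |frozE k u| ≤ (Cw * Real.exp (-κ * l1 (quo N u - U))) *
              (((d : ℝ) + 1) ^ 2 * Cl * Cr * (Cs * Ω) * Zl (d + 1) m ^ 2) :=
              mul_le_mul (hw ν U k u) (hfroz k u) (abs_nonneg _) (by positivity)
          _ = _ := by ring
  -- (4) the slot series of the remainders against the weighted block count
  have hg0 : ∀ u, 0 ≤ ω u * Real.exp (-(κ / 2) * l1 (quo N u - U)) := fun u => by have := (hω u).1; positivity
  have hgs : Summable fun u => ω u * Real.exp (-(κ / 2) * l1 (quo N u - U)) := by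
    refine Summable.of_nonneg_of_le hg0 (fun u => ?_) ((summable_leg (d := d) hN (half_pos hκ) U).mul_left Ω)
    exact mul_le_mul_of_nonneg_right (hω u).2 (Real.exp_pos _).le
  have hτ : min (κ / 4) κ = κ / 4 := min_eq_left (by linarith)
  have hslot : ∀ k, |∑' u, (w ν U k u * sandE k u - w ν U k u * frozE k u)|
      ≤ (Cw * A₀ * Real.exp (-(κ / 4) * (l1 (x' - U) + l1 (z' - U)))) * ∑' u, ω u * Real.exp (-(κ / 2) * l1 (quo N u - U)) := by
    intro k
    rw [← tsum_mul_left]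
    refine abs_tsum_le_tsum_of_abs_le (fun u => ?_) (hgs.mul_left _)
    rw [← mul_sub, abs_mul]
    have h3 := exp_three_le (d := d) hκ0 hκ0 (quo N u) U x' z'
    rw [hτ] at h3
    have hω0 := (hω u).1
    calc |w ν U k u| * |sandE k u - frozE k u| ≤ (Cw * EU u) * (A₀ * ω u * (Er u * El u)) :=
          mul_le_mul (hw ν U k u) (hrem k u) (abs_nonneg _) (by positivity)
      _ = Cw * A₀ * ω u * (EU u * El u * Er u) := by ring
      _ ≤ Cw * A₀ * ω u * (Real.exp (-(κ / 2) * l1 (quo N u - U)) * Real.exp (-(κ / 4) * (l1 (x' - U) + l1 (z' - U)))) :=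
          mul_le_mul_of_nonneg_left h3 (by positivity)
      _ = _ := by ring
  -- (5) assemble over the finitely many `κ′`
  rw [← Finset.sum_sub_distrib]
  have e : ∀ k, (∑' u, w ν U k u * sandE k u) - (∑' u, w ν U k u * frozE k u) = ∑' u, (w ν U k u * sandE k u - w ν U k u * frozE k u) :=
    fun k => ((hsumS k).tsum_sub (hsumF k)).symm
  calc |∑ k : Fin (d + 1), ((∑' u, w ν U k u * sandE k u) - ∑' u, w ν U k u * frozE k u)|
      ≤ ∑ k : Fin (d + 1), |(∑' u, w ν U k u * sandE k u) - ∑' u, w ν U k u * frozE k u| := Finset.abs_sum_le_sum_abs _ _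
    _ ≤ ∑ _k : Fin (d + 1), (Cw * A₀ * Real.exp (-(κ / 4) * (l1 (x' - U) + l1 (z' - U)))) *
          ∑' u, ω u * Real.exp (-(κ / 2) * l1 (quo N u - U)) := Finset.sum_le_sum fun k _ => by rw [e k]; exact hslot k
    _ = _ := by
        simp only [Finset.sum_const, Finset.card_univ, Fintype.card_fin, nsmul_eq_mul, hA₀]
        push_cast
        ring

/-- NOT IN PRINT; OUR BOOKKEEPING.  **ZERO PER-SLOT FIELD–FIELD CHARGE ⇒ THE PUSH CARRIES ONE GRADIENT CONSTANT** (the (LT-Δ) gain in generic currency): under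
the hypotheses of `abs_push₃_sub_frozen_le_weighted`, if every kernel of the family has vanishing field–field charge at every fibre pair,
`Σ'_x Σ'_z S κ′ u x z (inl κ₁) (inl κ₂) = 0`, then
`|push₃ l r w S ν U x′ z′ (inl α) (inl β)| ≤ (d+1)³·Cw·Cs·M₁·(Cr′·Cl·Zl(m−κ) + Cr·Cl′·Zl m)·e^{−(κ∕4)(‖x′−U‖₁+‖z′−U‖₁)}·Σ'_u ω u·e^{−(κ∕2)‖quo N u − U‖₁}` —
`LayerPushEntry.abs_push₃_inl_inl_le_weighted` with ONE of the two kernel-leg constants replaced by its gradient constant. -/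
theorem abs_push₃_inl_inl_le_of_zeroCharge (hN : 1 ≤ N)
    (hl : ∀ α x' k x, |l α x' k x| ≤ Cl * Real.exp (-κ * l1 (quo N x - x')))
    (hl' : ∀ α x' k x i, |l α x' k (x + Pi.single i 1) - l α x' k x| ≤ Cl' * Real.exp (-κ * l1 (quo N x - x')))
    (hr : ∀ β z' k z, |r β z' k z| ≤ Cr * Real.exp (-κ * l1 (quo N z - z')))
    (hr' : ∀ β z' k z i, |r β z' k (z + Pi.single i 1) - r β z' k z| ≤ Cr' * Real.exp (-κ * l1 (quo N z - z')))
    (hw : ∀ ν U k u, |w ν U k u| ≤ Cw * Real.exp (-κ * l1 (quo N u - U)))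
    (hS : ∀ k u x z a b, |S k u x z a b| ≤ Cs * ω u * Real.exp (-m * (l1 (x - u) + l1 (z - u))))
    (hω : ∀ u, 0 ≤ ω u ∧ ω u ≤ Ω) (hκ : 0 < κ) (hm : κ < m) (hCl : 0 ≤ Cl) (hCl' : 0 ≤ Cl') (hCr : 0 ≤ Cr) (hCr' : 0 ≤ Cr')
    (hCs : 0 ≤ Cs) (hZ : ∀ k u κ₁ κ₂, ∑' x, ∑' z, S k u x z (Sum.inl κ₁) (Sum.inl κ₂) = 0)
    (ν : Fin (d + 1)) (U x' z' : Fin (d + 1) → ℤ) (α β : Fin (d + 1)) :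
    |push₃ l r w S ν U x' z' (Sum.inl α) (Sum.inl β)|
      ≤ (((d : ℝ) + 1) ^ 3 * Cw * Cs * (2 / (m - κ) * Zl (d + 1) ((m - κ) / 2)) *
          (Cr' * Cl * Zl (d + 1) (m - κ) + Cr * Cl' * Zl (d + 1) m)) *
        Real.exp (-(κ / 4) * (l1 (x' - U) + l1 (z' - U))) *
          ∑' u : Fin (d + 1) → ℤ, ω u * Real.exp (-(κ / 2) * l1 (quo N u - U)) := by
  have h := abs_push₃_sub_frozen_le_weighted hN hl hl' hr hr' hw hS hω hκ hm hCl hCl' hCr hCr' hCs ν U x' z' α β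
  simpa only [hZ, mul_zero, Finset.sum_const_zero, tsum_zero, sub_zero] using h

end Main

/-! ## §4 What a commutator letter's per-slot field–field charge is: fibre-ANTISYMMETRIC (diagonal zero), not zero -/

section Charge

/-- NOT IN PRINT; OUR BOOKKEEPING ([folklore] one product-dominated Fubini).  **THE PER-SLOT FIELD–FIELD CHARGE OF A COMMUTATOR LETTER IS FIBRE-ANTISYMMETRIC.**
For a kernel `K` whose FIELD–FIELD block is symmetric, `K x z (inl κ₁) (inl κ₂) = K z x (inl κ₂) (inl κ₁)` (the co-dressed step resolvent `G_j` is `sgnK`-symmetric BY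
NAME — `BubbleParity.trK_coDressKBmAt_KInvStep` — hence symmetric on the ff block; nothing is assumed on the mixed blocks), localised at a base point
(`|K x z (inl κ₁) (inl κ₂)| ≤ B·e^{−m(‖x−u‖₁+‖z−u‖₁)}`, `m > 0`), and any bounded multiplier `g` on (site × fibre) (`|g x a| ≤ 1`; the block indicator read at the leg site,
leaf-03's `LayerCommutatorSupport.comm_diagK_legInd_entry`), the commutator letter `D x z a b := K x z a b·(g z b − g x a)` has
`Σ'_x Σ'_z D x z (inl κ₁) (inl κ₂) = −Σ'_x Σ'_z D x z (inl κ₂) (inl κ₁)`: its field–field charge MATRIX is antisymmetric in the fibre pair — the diagonal charges vanish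
(`charge_comm_diag_eq_zero`), the off-diagonal ones are NOT asserted to (the OWNER's W11 (1): «an ANTISYMMETRIC fibre matrix, zero diagonal, nonzero off-diagonal»;
idea-1's WARD8 (0.3); the abstract-kernel twin is leaf-03 g59's `LayerCommutatorAntisymm` §3). -/
theorem charge_comm_antisymm {K : MKer (d + 1) (Fib d)} {g : (Fin (d + 1) → ℤ) → Fib d → ℝ} {u : Fin (d + 1) → ℤ} {B m : ℝ} (hm : 0 < m)
    (hKs : ∀ x z κ₁ κ₂, K x z (Sum.inl κ₁) (Sum.inl κ₂) = K z x (Sum.inl κ₂) (Sum.inl κ₁))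
    (hKb : ∀ x z κ₁ κ₂, |K x z (Sum.inl κ₁) (Sum.inl κ₂)| ≤ B * Real.exp (-m * (l1 (x - u) + l1 (z - u))))
    (hg : ∀ x a, |g x a| ≤ 1) (κ₁ κ₂ : Fin (d + 1)) :
    ∑' x, ∑' z, K x z (Sum.inl κ₁) (Sum.inl κ₂) * (g z (Sum.inl κ₂) - g x (Sum.inl κ₁))
      = -∑' x, ∑' z, K x z (Sum.inl κ₂) (Sum.inl κ₁) * (g z (Sum.inl κ₁) - g x (Sum.inl κ₂)) := by
  have hB : 0 ≤ B := by
    have h := hKb u u κ₁ κ₂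
    rw [sub_self, show l1 (0 : Fin (d + 1) → ℤ) = 0 by simp [l1], add_zero, mul_zero, Real.exp_zero, mul_one] at h
    exact (abs_nonneg _).trans h
  have hPB : ProdBound fun x z => K x z (Sum.inl κ₂) (Sum.inl κ₁) * (g z (Sum.inl κ₁) - g x (Sum.inl κ₂)) := by
    refine ⟨fun x => 2 * B * Real.exp (-m * l1 (x - u)), fun z => Real.exp (-m * l1 (z - u)),
      (summable_exp_shift' hm u).mul_left _, summable_exp_shift' hm u, fun x => by positivity, fun z => (Real.exp_pos _).le,
      fun x z => ?_⟩
    rw [abs_mul]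
    have hd : |g z (Sum.inl κ₁) - g x (Sum.inl κ₂)| ≤ 2 := by
      have := abs_sub (g z (Sum.inl κ₁)) (g x (Sum.inl κ₂)); linarith [hg z (Sum.inl κ₁), hg x (Sum.inl κ₂)]
    calc |K x z (Sum.inl κ₂) (Sum.inl κ₁)| * |g z (Sum.inl κ₁) - g x (Sum.inl κ₂)|
        ≤ (B * Real.exp (-m * (l1 (x - u) + l1 (z - u)))) * 2 := mul_le_mul (hKb x z κ₂ κ₁) hd (abs_nonneg _) (by positivity)
      _ = 2 * B * Real.exp (-m * l1 (x - u)) * Real.exp (-m * l1 (z - u)) := by rw [mul_add, Real.exp_add]; ring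
  rw [tsum_comm_of_prodBound hPB, ← tsum_neg]
  refine tsum_congr fun x => ?_
  rw [← tsum_neg]
  refine tsum_congr fun z => ?_
  rw [hKs x z κ₁ κ₂]
  ring

/-- [folklore] **THE FIBRE-DIAGONAL CHARGES OF A COMMUTATOR LETTER VANISH** (`a = −a ⇒ a = 0`). -/
theorem charge_comm_diag_eq_zero {K : MKer (d + 1) (Fib d)} {g : (Fin (d + 1) → ℤ) → Fib d → ℝ} {u : Fin (d + 1) → ℤ} {B m : ℝ}
    (hm : 0 < m) (hKs : ∀ x z κ₁ κ₂, K x z (Sum.inl κ₁) (Sum.inl κ₂) = K z x (Sum.inl κ₂) (Sum.inl κ₁))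
    (hKb : ∀ x z κ₁ κ₂, |K x z (Sum.inl κ₁) (Sum.inl κ₂)| ≤ B * Real.exp (-m * (l1 (x - u) + l1 (z - u))))
    (hg : ∀ x a, |g x a| ≤ 1) (κ₁ : Fin (d + 1)) :
    ∑' x, ∑' z, K x z (Sum.inl κ₁) (Sum.inl κ₁) * (g z (Sum.inl κ₁) - g x (Sum.inl κ₁)) = 0 := by
  have h := charge_comm_antisymm hm hKs hKb hg κ₁ κ₁
  linarith

end Charge

end Summit.QuantumFields.BalabanUV.Beta.GAN24.LayerPushFrozen

end
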